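import Mathlib.GroupTheory.RegularWreathProduct
import Mathlib.Data.ZMod.Basic
import Literature.Computability.AlgebraicComplexity.CohnUmansTPP
import Literature.Computability.AlgebraicComplexity.CohnUmansTPPProofs
import Literature.RepresentationTheory.FiniteGroups.AbelianSubgroupDegreeBound
import HarnessLib

/-!
# CKSU 2005, §2 "Beating the sum of the cubes": `(Cyc_n³ × Cyc_n³) ⋊ Cyc₂` realizes `⟨2n(n−1), 2n(n−1), 2n(n−1)⟩`

Topic `Literature/Computability/AlgebraicComplexity`. Source: H. Cohn, R. Kleinberg, B. Szegedy, C. Umans,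
*Group-theoretic algorithms for matrix multiplication*, FOCS 2005, §2 (arXiv:math/0511460, held text
`paper:arxiv-math_0511460`, chunks p0004 L160 – p0005 L66; FOCS numbering Lemma 2.1 = arXiv Lemma 10).
This is the first group in print that proves a non-trivial bound on `ω` through the triple product
property (answering Question 4.1 of Cohn–Umans 2003), the census's family-(b) control row R24
(`ω < 2.9088`).

As printed (p0004–p0005): "Let `H = Cyc_n³`, and let `G = H² ⋊ Cyc₂`, where `Cyc₂` acts on `H²` by
switching the two factors of `H`. Let `z` denote the generator of `Cyc₂`. We write elements of `G` in the
form `(a, b)zⁱ`, with `a, b ∈ H` and `i ∈ {0,1}`. … Let `H₁, H₂, H₃` be the three factors of `Cyc_n` in the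
product `H = Cyc_n³`, viewed as subgroups of `H`. For notational convenience, let `H₄ = H₁`. Define
subsets `S₁, S₂, S₃ ⊆ G` by `Sᵢ = {(a,b)zʲ : a ∈ Hᵢ ∖ {0}, b ∈ H_{i+1}, j ∈ {0,1}}`."
**Lemma 2.1 / 10.** "`S₁`, `S₂`, and `S₃` satisfy the triple product property."
"The character degrees of `G` are all at most `2`, because `H²` is an abelian subgroup of index `2`. …
`|Sᵢ| = 2n(n−1)` … By Corollary 1.9, `(2n(n−1))^ω ≤ 2^{ω−2} 2n⁶`. The best bound on `ω` is achieved by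
setting `n = 17`, in which case we obtain `ω < 2.9088`."

## Formalisation

* `G` is Mathlib's regular wreath product `(Fin 3 → C) ≀ᵣ Multiplicative (ZMod 2)` — literally
  `(H × H) ⋊ Cyc₂` with `Cyc₂` switching the factors, `H = C³` — for an arbitrary finite abelian group `C`
  in place of `Cyc_n` (the proof only uses the coordinate structure; `n := |C|`): `cksuGroup C`.
* `cksuSet C i i'` (`(i, i') = (0,1), (1,2), (2,0)`) are the three sets `Sᵢ`; `card_cksuSet`:
  `|Sᵢ| = 2n(n−1)`.
* `cksu_tpp` is Lemma 2.1 / 10, by the printed case analysis on the number of `z`'s among the three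
  quotients (even; none ⇒ coordinatewise cancellation; two ⇒ some `aᵢ ≠ 0` stands alone in a
  coordinate); `realizesTPP_cksuGroup`: `G` realizes `⟨2n(n−1), 2n(n−1), 2n(n−1)⟩` in the tree's sense
  (`RealizesTPP`, `CohnUmansTPP.lean`).
* `maxCharDegree_cksuGroup_le_two` ("at most `2`, because `H²` is an abelian subgroup of index `2`") from
  Serre's Cor. to Thm. 9 (`AbelianSubgroupDegreeBound.lean`); `card_cksuGroup`: `|G| = 2n⁶`.
* `CohnKleinbergSzegedyUmans2005_sec2_ineq`: the displayed `(2n(n−1))^ω ≤ 2^{ω−2} · 2n⁶`, from the tree's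
  PROVED Cor. 1.9 (`CKSU2005_cor19_holds`); solved for `ω`: `omega_le_of_cksu_sec2`
  (`ω ≤ (6 log n − log 2)/log(n(n−1))`, `n ≥ 2`); `omega_le_cksu_sec2_seventeen` (`n = 17`:
  `ω ≤ (6 log 17 − log 2)/log 272`); `CohnKleinbergSzegedyUmans2005_sec2 : ω < 2.9088` (integer
  certificate `17^3750 < 2^625 · 272^1818`); and "For `n ≥ 5`, this product is
  larger than `4n⁶`", i.e. the bound is non-trivial: `omega_lt_three_of_cksu_sec2`.

0 named facts; theorems only. Not a competitive bound (the tree has `ω < 2.373`): it is the published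
family-(b2-W) control re-derived end-to-end in the kernel.
-/

noncomputable section

namespace Literature.Computability.AlgebraicComplexity

open RegularWreathProduct Literature.RepresentationTheory.FiniteGroups

namespace CKSUIndexTwo

/-- The two-element group `Cyc₂` of CKSU §2, written multiplicatively. [cite: CohnKleinbergSzegedyUmans2005, §2] -/
abbrev Q : Type := Multiplicative (ZMod 2)

/-- "Let `z` denote the generator of `Cyc₂`." [cite: CohnKleinbergSzegedyUmans2005, §2] -/
def z : Q := Multiplicative.ofAdd 1

/-- `z ≠ 1`. [folklore] -/
private theorem z_ne_one : z ≠ 1 := by decide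

/-- `z² = 1`. [folklore] -/
private theorem z_mul_z : z * z = 1 := by decide

/-- `z⁻¹ = z`. [folklore] -/
private theorem z_inv : z⁻¹ = z := by decide

/-- `Cyc₂ = {1, z}`. [folklore] -/
private theorem Q_cases (q : Q) : q = 1 ∨ q = z := by
  have h : ∀ a : ZMod 2, Multiplicative.ofAdd a = (1 : Q) ∨ Multiplicative.ofAdd a = z := by decide
  exact h (Multiplicative.toAdd q)

section Pair

variable (C : Type)

/-- The pair `(x, y) ∈ H²` as a function on `Cyc₂` (`1 ↦ x`, `z ↦ y`): "We write elements of `G` in the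
form `(a, b)zⁱ`, with `a, b ∈ H`". [cite: CohnKleinbergSzegedyUmans2005, §2] -/
def pairFun (x y : Fin 3 → C) : Q → (Fin 3 → C) := fun q => if q = 1 then x else y

variable {C}

/-- First component. [folklore] -/
private theorem pairFun_one (x y : Fin 3 → C) : pairFun C x y 1 = x := by simp [pairFun]

/-- Second component. [folklore] -/
private theorem pairFun_z (x y : Fin 3 → C) : pairFun C x y z = y := by simp [pairFun, z_ne_one]

end Pair

section Group

variable (C : Type) [CommGroup C]

/-- **CKSU's group** `G = H² ⋊ Cyc₂`, `H = C³`, `Cyc₂` switching the two factors: the regular wreath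
product `(Fin 3 → C) ≀ᵣ Cyc₂` (elements `⟨f, q⟩`, `f : Cyc₂ → C³` the pair `(f 1, f z)`).
[cite: CohnKleinbergSzegedyUmans2005, §2] -/
abbrev cksuGroup : Type := (Fin 3 → C) ≀ᵣ Q

/-- The element `(a eᵢ, b e_{i'}) zʲ` of `G` (`a` in the `i`-th factor of the first copy of `H`, `b` in the
`i'`-th factor of the second copy). [cite: CohnKleinbergSzegedyUmans2005, §2] -/
def sElt (i i' : Fin 3) (a b : C) (q : Q) : cksuGroup C :=
  ⟨pairFun C (Pi.mulSingle i a) (Pi.mulSingle i' b), q⟩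

/-- The right quotient `(a eᵢ, b e_{i'}) zʲ · ((a' eᵢ, b' e_{i'}) z^{j'})⁻¹` only depends on `ε = z^{j−j'}`:
it is `⟨x ↦ (a,b)(x) · (a',b')(ε⁻¹x)⁻¹, ε⟩` (`sElt_mul_inv`) — "Each quotient `qᵢ` is either of the form
`(aᵢ,bᵢ)(−aᵢ',−bᵢ')` or of the form `(aᵢ,bᵢ)z(−aᵢ',−bᵢ')`".
[cite: CohnKleinbergSzegedyUmans2005, Lemma 2.1 (arXiv Lemma 10), proof] -/
def quotElt (i i' : Fin 3) (a b a' b' : C) (ε : Q) : cksuGroup C :=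
  ⟨fun x => pairFun C (Pi.mulSingle i a) (Pi.mulSingle i' b) x *
      (pairFun C (Pi.mulSingle i a') (Pi.mulSingle i' b') (ε⁻¹ * x))⁻¹, ε⟩

variable {C}

/-- `(a, b, j) ↦ (a eᵢ, b e_{i'}) zʲ` is injective. [folklore] -/
private theorem sElt_injective (i i' : Fin 3) :
    Function.Injective fun t : C × C × Q => sElt C i i' t.1 t.2.1 t.2.2 := by
  rintro ⟨a, b, q⟩ ⟨a', b', q'⟩ h
  simp only [sElt, RegularWreathProduct.mk.injEq] at h
  obtain ⟨hf, rfl⟩ := h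
  have h1 := congrFun hf 1
  have hz := congrFun hf z
  simp only [pairFun_one, pairFun_z] at h1 hz
  simp [Pi.mulSingle_injective i h1, Pi.mulSingle_injective i' hz]

/-- The two shapes of a right quotient of `Sᵢ`: `s s'⁻¹ = quotElt … (z^{j−j'})`.
[cite: CohnKleinbergSzegedyUmans2005, Lemma 2.1 (arXiv Lemma 10), proof] -/
theorem sElt_mul_inv (i i' : Fin 3) (a b a' b' : C) (j j' : Q) :
    sElt C i i' a b j * (sElt C i i' a' b' j')⁻¹ = quotElt C i i' a b a' b' (j * j'⁻¹) := by
  apply RegularWreathProduct.ext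
  · funext x
    simp only [sElt, quotElt, RegularWreathProduct.mul_left, RegularWreathProduct.inv_left,
      Pi.mul_apply, Pi.inv_apply, mul_inv_rev, inv_inv, mul_assoc]
  · simp [sElt, quotElt]

/-! ### Lemma 2.1 / 10: the triple product property -/

/-- **Lemma 2.1 / 10, the computation.** If the product of the three quotients is `1` then there are no
`z`'s and everything cancels coordinatewise ("First, suppose there are none … the triple product property
holds (trivially) for `H₁, H₂, H₃` in `H`"); with two `z`'s some `aᵢ` is the only summand from `Hᵢ` in one
coordinate ("Since `aᵢ` and `aᵢ'` are nonzero … the product cannot be the identity").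
[cite: CohnKleinbergSzegedyUmans2005, Lemma 2.1 (arXiv Lemma 10)] -/
theorem quotElt_mul_eq_one {a₀ b₀ a₀' b₀' a₁ b₁ a₁' b₁' a₂ b₂ a₂' b₂' : C} {ε₀ ε₁ ε₂ : Q}
    (ha₀ : a₀ ≠ 1) (ha₁ : a₁ ≠ 1) (ha₂ : a₂ ≠ 1)
    (h : quotElt C 0 1 a₀ b₀ a₀' b₀' ε₀ * quotElt C 1 2 a₁ b₁ a₁' b₁' ε₁ *
      quotElt C 2 0 a₂ b₂ a₂' b₂' ε₂ = 1) :
    (a₀ = a₀' ∧ b₀ = b₀' ∧ ε₀ = 1) ∧ (a₁ = a₁' ∧ b₁ = b₁' ∧ ε₁ = 1) ∧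
      (a₂ = a₂' ∧ b₂ = b₂' ∧ ε₂ = 1) := by
  have hR := congrArg RegularWreathProduct.right h
  have hL := fun x c => congrFun (congrFun (congrArg RegularWreathProduct.left h) x) c
  have h10 := hL 1 0
  have h11 := hL 1 1
  have h12 := hL 1 2
  have hz0 := hL z 0
  have hz1 := hL z 1
  have hz2 := hL z 2
  clear hL h
  rcases Q_cases ε₀ with rfl | rfl <;> rcases Q_cases ε₁ with rfl | rfl <;>
    rcases Q_cases ε₂ with rfl | rfl
  · -- no `z` at all: coordinatewise cancellation
    simp [quotElt, pairFun_one, pairFun_z, mul_inv_eq_one] at h10 h11 h12 hz0 hz1 hz2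
    exact ⟨⟨h10, hz1, rfl⟩, ⟨h11, hz2, rfl⟩, ⟨h12, hz0, rfl⟩⟩
  · -- an odd number of `z`'s is impossible
    exact absurd (by simpa [quotElt] using hR) z_ne_one
  · exact absurd (by simpa [quotElt] using hR) z_ne_one
  · -- `z`'s in `q₁, q₂`: `a₁` stands alone in the `H₁`-coordinate of the first copy
    simp [quotElt, pairFun, z_ne_one, z_inv, z_mul_z] at h11
    exact absurd h11 ha₁
  · exact absurd (by simpa [quotElt] using hR) z_ne_one
  · -- `z`'s in `q₀, q₂`: `a₂` stands alone in the `H₂`-coordinate of the second copy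
    simp [quotElt, pairFun, z_ne_one, z_inv, z_mul_z] at hz2
    exact absurd hz2 ha₂
  · -- `z`'s in `q₀, q₁`: `a₀` stands alone in the `H₀`-coordinate of the first copy
    simp [quotElt, pairFun, z_ne_one, z_inv, z_mul_z] at h10
    exact absurd h10 ha₀
  · exact absurd (by simpa [quotElt, z_mul_z] using hR) z_ne_one

/-! ### "The character degrees of `G` are all at most 2" -/

/-- The subgroup `H² = {(a,b)z⁰}` ("an abelian subgroup of index `2`"): the kernel of the projection to
`Cyc₂`. [cite: CohnKleinbergSzegedyUmans2005, §2] -/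
def baseSubgroup : Subgroup (cksuGroup C) := (RegularWreathProduct.rightHom : cksuGroup C →* Q).ker

/-- Membership in `H²`. [folklore] -/
private theorem mem_baseSubgroup {w : cksuGroup C} : w ∈ baseSubgroup (C := C) ↔ w.right = 1 :=
  MonoidHom.mem_ker

/-- "`H²` is an abelian subgroup": the base of the wreath product is commutative. [folklore] -/
instance : IsMulCommutative (baseSubgroup (C := C)) :=
  ⟨⟨fun a b => by
    apply Subtype.ext
    have ha : a.1.right = 1 := mem_baseSubgroup.mp a.2
    have hb : b.1.right = 1 := mem_baseSubgroup.mp b.2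
    apply RegularWreathProduct.ext
    · funext x
      simp only [Subgroup.coe_mul, RegularWreathProduct.mul_left, ha, hb, inv_one, one_mul,
        Pi.mul_apply]
      exact mul_comm _ _
    · simp only [Subgroup.coe_mul, RegularWreathProduct.mul_right, ha, hb]⟩⟩

/-- "`H²` is an abelian subgroup of index `2`." [cite: CohnKleinbergSzegedyUmans2005, §2] -/
theorem index_baseSubgroup : (baseSubgroup (C := C)).index = 2 := by
  have hsurj : Function.Surjective (RegularWreathProduct.rightHom : cksuGroup C →* Q) :=
    fun q => ⟨RegularWreathProduct.inl q, rfl⟩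
  rw [baseSubgroup, Subgroup.index_ker, MonoidHom.range_eq_top.mpr hsurj, Subgroup.card_top,
    Nat.card_eq_fintype_card, Fintype.card_multiplicative, ZMod.card]

/-- `H²` has finite index. [folklore] -/
instance : (baseSubgroup (C := C)).FiniteIndex := ⟨by rw [index_baseSubgroup]; decide⟩

/-- "The character degrees of `G` are all at most `2`, because `H²` is an abelian subgroup of index
`2`" (Serre, §3.1, Cor. to Thm. 9). [cite: CohnKleinbergSzegedyUmans2005, §2] -/
theorem maxCharDegree_cksuGroup_le_two : maxCharDegree (cksuGroup C) ≤ 2 :=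
  (maxCharDegree_le_index (baseSubgroup (C := C))).trans index_baseSubgroup.le

end Group

section Sets

variable (C : Type) [CommGroup C] [Fintype C] [DecidableEq C]

/-- Decidable equality on `G` (through `(Cyc₂ → C³) × Cyc₂`). [folklore] -/
instance : DecidableEq (cksuGroup C) := (RegularWreathProduct.equivProd _ _).decidableEq

/-- **The sets `Sᵢ = {(a,b)zʲ : a ∈ Hᵢ ∖ {0}, b ∈ H_{i+1}, j ∈ {0,1}}`** (we index the three factors by
`Fin 3` and pass `(i, i+1)` explicitly: `S₁ = cksuSet 0 1`, `S₂ = cksuSet 1 2`, `S₃ = cksuSet 2 0`).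
[cite: CohnKleinbergSzegedyUmans2005, §2] -/
def cksuSet (i i' : Fin 3) : Finset (cksuGroup C) :=
  ((Finset.univ.erase (1 : C)) ×ˢ ((Finset.univ : Finset C) ×ˢ (Finset.univ : Finset Q))).image
    fun t => sElt C i i' t.1 t.2.1 t.2.2

variable {C}

/-- Membership in `Sᵢ`: `s = (a eᵢ, b e_{i'}) zʲ` with `a ≠ 1`. [cite: CohnKleinbergSzegedyUmans2005, §2] -/
theorem mem_cksuSet {i i' : Fin 3} {s : cksuGroup C} :
    s ∈ cksuSet C i i' ↔ ∃ a b q, a ≠ 1 ∧ s = sElt C i i' a b q := by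
  constructor
  · intro h
    obtain ⟨⟨a, b, q⟩, ht, rfl⟩ := Finset.mem_image.mp h
    have ha : a ≠ 1 := by simpa using ht
    exact ⟨a, b, q, ha, rfl⟩
  · rintro ⟨a, b, q, ha, rfl⟩
    exact Finset.mem_image.mpr ⟨(a, b, q), by simp [ha], rfl⟩

/-- `|Sᵢ| = 2n(n−1)` (`n = |C|`). [cite: CohnKleinbergSzegedyUmans2005, §2] -/
theorem card_cksuSet (i i' : Fin 3) :
    (cksuSet C i i').card = 2 * Fintype.card C * (Fintype.card C - 1) := by
  rw [cksuSet, Finset.card_image_of_injective _ (sElt_injective i i'), Finset.card_product,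
    Finset.card_product, Finset.card_erase_of_mem (Finset.mem_univ _), Finset.card_univ,
    Finset.card_univ, Fintype.card_multiplicative, ZMod.card]
  ring

/-- **CKSU 2005, Lemma 2.1 (arXiv Lemma 10): "`S₁`, `S₂`, and `S₃` satisfy the triple product
property"** — in the tree's `Q(S)`-form: `s s'⁻¹ · t t'⁻¹ · u u'⁻¹ = 1` with `s, s' ∈ S₁`, `t, t' ∈ S₂`,
`u, u' ∈ S₃` forces `s = s'`, `t = t'`, `u = u'`. [cite: CohnKleinbergSzegedyUmans2005, Lemma 2.1 (arXiv Lemma 10)] -/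
theorem cksu_tpp :
    ∀ s ∈ cksuSet C 0 1, ∀ s' ∈ cksuSet C 0 1, ∀ t ∈ cksuSet C 1 2, ∀ t' ∈ cksuSet C 1 2,
      ∀ u ∈ cksuSet C 2 0, ∀ u' ∈ cksuSet C 2 0,
      s * s'⁻¹ * (t * t'⁻¹) * (u * u'⁻¹) = 1 → s = s' ∧ t = t' ∧ u = u' := by
  intro s hs s' hs' t ht t' ht' u hu u' hu' h
  obtain ⟨a₀, b₀, j₀, ha₀, rfl⟩ := mem_cksuSet.mp hs
  obtain ⟨a₀', b₀', j₀', -, rfl⟩ := mem_cksuSet.mp hs'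
  obtain ⟨a₁, b₁, j₁, ha₁, rfl⟩ := mem_cksuSet.mp ht
  obtain ⟨a₁', b₁', j₁', -, rfl⟩ := mem_cksuSet.mp ht'
  obtain ⟨a₂, b₂, j₂, ha₂, rfl⟩ := mem_cksuSet.mp hu
  obtain ⟨a₂', b₂', j₂', -, rfl⟩ := mem_cksuSet.mp hu'
  rw [sElt_mul_inv, sElt_mul_inv, sElt_mul_inv] at h
  obtain ⟨⟨ha, hb, h₀⟩, ⟨ha', hb', h₁⟩, ⟨ha'', hb'', h₂⟩⟩ := quotElt_mul_eq_one ha₀ ha₁ ha₂ h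
  rw [mul_inv_eq_one] at h₀ h₁ h₂
  subst ha hb h₀ ha' hb' h₁ ha'' hb'' h₂
  exact ⟨rfl, rfl, rfl⟩

/-- **`G = (C³ × C³) ⋊ Cyc₂` realizes `⟨2n(n−1), 2n(n−1), 2n(n−1)⟩`** (`n = |C|`) through the sets `Sᵢ`
of CKSU 2005, §2. [cite: CohnKleinbergSzegedyUmans2005, Lemma 2.1 (arXiv Lemma 10)] -/
theorem realizesTPP_cksuGroup :
    RealizesTPP (cksuGroup C) (2 * Fintype.card C * (Fintype.card C - 1))
      (2 * Fintype.card C * (Fintype.card C - 1)) (2 * Fintype.card C * (Fintype.card C - 1)) :=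
  ⟨cksuSet C 0 1, cksuSet C 1 2, cksuSet C 2 0, card_cksuSet 0 1, card_cksuSet 1 2, card_cksuSet 2 0,
    cksu_tpp⟩

omit [CommGroup C] [DecidableEq C] in
/-- `|G| = 2n⁶`. [cite: CohnKleinbergSzegedyUmans2005, §2] -/
theorem card_cksuGroup : Nat.card (cksuGroup C) = 2 * Fintype.card C ^ 6 := by
  rw [RegularWreathProduct.card, Nat.card_fun]
  simp only [Nat.card_eq_fintype_card, Fintype.card_fin, Fintype.card_multiplicative, ZMod.card]
  ring

/-! ### The bound on `ω` -/

/-- **CKSU 2005, §2, the displayed inequality: "By Corollary 1.9, `(2n(n−1))^ω ≤ 2^{ω−2} 2n⁶`"**, for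
`G = (C³ × C³) ⋊ Cyc₂`, `n = |C|`, from the tree's proved Cor. 1.9 (`CKSU2005_cor19_holds`), the
realization `realizesTPP_cksuGroup`, `d_max ≤ 2` and `|G| = 2n⁶`.
[cite: CohnKleinbergSzegedyUmans2005, §2] -/
theorem CohnKleinbergSzegedyUmans2005_sec2_ineq :
    ((2 * Fintype.card C * (Fintype.card C - 1) : ℕ) : ℝ) ^ omega ℂ ≤
      (2 : ℝ) ^ (omega ℂ - 2) * (2 * (Fintype.card C : ℝ) ^ 6) := by
  have h := CKSU2005_cor19_holds.rpow_le_of_maxCharDegree_le (realizesTPP_cksuGroup (C := C))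
    (maxCharDegree_cksuGroup_le_two (C := C))
  rw [card_cksuGroup] at h
  generalize 2 * Fintype.card C * (Fintype.card C - 1) = N at h
  have hpow : ((N * N * N : ℕ) : ℝ) ^ (omega ℂ / 3) = (N : ℝ) ^ omega ℂ := by
    rw [show ((N * N * N : ℕ) : ℝ) = (N : ℝ) ^ (3 : ℕ) by push_cast; ring,
      ← Real.rpow_natCast, ← Real.rpow_mul (Nat.cast_nonneg N)]
    congr 1
    push_cast
    ring
  rw [hpow] at h
  refine h.trans (le_of_eq ?_)
  push_cast
  ring

/-- The inequality solved for `ω`: for `n = |C| ≥ 2`, **`ω ≤ (6 log n − log 2) / log (n(n−1))`**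
(`= log(n⁶/2)/log(n(n−1))`; at `n = 17` this is `log(24137569/2)/log 272 = 2.90879…`).
[cite: CohnKleinbergSzegedyUmans2005, §2] -/
theorem omega_le_of_cksu_sec2 (hn : 2 ≤ Fintype.card C) :
    omega ℂ ≤ (6 * Real.log (Fintype.card C) - Real.log 2) /
      Real.log ((Fintype.card C : ℝ) * ((Fintype.card C : ℝ) - 1)) := by
  have h := CohnKleinbergSzegedyUmans2005_sec2_ineq (C := C)
  generalize Fintype.card C = n at h hn ⊢
  have h2 : (2 : ℝ) ≤ n := by exact_mod_cast hn
  have hnpos : (0 : ℝ) < n := by linarith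
  have hmpos : (0 : ℝ) < (n : ℝ) * ((n : ℝ) - 1) := by nlinarith
  have hm : (1 : ℝ) < (n : ℝ) * ((n : ℝ) - 1) := by nlinarith
  have hlogm : 0 < Real.log ((n : ℝ) * ((n : ℝ) - 1)) := Real.log_pos hm
  have hcast : ((2 * n * (n - 1) : ℕ) : ℝ) = 2 * ((n : ℝ) * ((n : ℝ) - 1)) := by
    rw [Nat.cast_mul, Nat.cast_mul, Nat.cast_sub (by omega)]
    push_cast
    ring
  rw [hcast] at h
  have hlhs : (0 : ℝ) < 2 * ((n : ℝ) * ((n : ℝ) - 1)) := by linarith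
  have hlog := Real.log_le_log (Real.rpow_pos_of_pos hlhs _) h
  rw [Real.log_rpow hlhs, Real.log_mul (by norm_num) hmpos.ne',
    Real.log_mul (x := (2 : ℝ) ^ (omega ℂ - 2)) (y := 2 * (n : ℝ) ^ 6) (by positivity) (by positivity),
    Real.log_rpow (by norm_num : (0 : ℝ) < 2),
    Real.log_mul (x := (2 : ℝ)) (y := (n : ℝ) ^ 6) (by norm_num) (by positivity), Real.log_pow] at hlog
  push_cast at hlog
  rw [le_div_iff₀ hlogm]
  linarith

/-- **"For `n ≥ 5`, this product is larger than `4n⁶`"**: the bound is non-trivial, `ω < 3`, as soon as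
`n = |C| ≥ 5` (`8n³(n−1)³ > 4n⁶`). [cite: CohnKleinbergSzegedyUmans2005, §2] -/
theorem omega_lt_three_of_cksu_sec2 (hn : 5 ≤ Fintype.card C) : omega ℂ < 3 := by
  have h := omega_le_of_cksu_sec2 (C := C) (by omega)
  generalize Fintype.card C = n at h hn
  have h5 : (5 : ℝ) ≤ n := by exact_mod_cast hn
  have hnpos : (0 : ℝ) < n := by linarith
  have hm : (1 : ℝ) < (n : ℝ) * ((n : ℝ) - 1) := by nlinarith
  have hmpos : (0 : ℝ) < (n : ℝ) * ((n : ℝ) - 1) := by linarith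
  have hlogm : 0 < Real.log ((n : ℝ) * ((n : ℝ) - 1)) := Real.log_pos hm
  refine lt_of_le_of_lt h ?_
  rw [div_lt_iff₀ hlogm]
  -- `6 log n − log 2 < 3 log (n(n−1))` iff `n⁶ < 2 (n(n−1))³` iff `n³ < 2(n−1)³`
  have ht : (0 : ℝ) ≤ (n : ℝ) - 5 := by linarith
  have h3 : (n : ℝ) ^ 3 < 2 * ((n : ℝ) - 1) ^ 3 := by
    nlinarith [mul_nonneg ht ht, mul_nonneg (mul_nonneg ht ht) ht]
  have key : (n : ℝ) ^ 6 < 2 * ((n : ℝ) * ((n : ℝ) - 1)) ^ 3 := by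
    have hn3 : (0 : ℝ) < (n : ℝ) ^ 3 := by positivity
    calc (n : ℝ) ^ 6 = (n : ℝ) ^ 3 * (n : ℝ) ^ 3 := by ring
      _ < (n : ℝ) ^ 3 * (2 * ((n : ℝ) - 1) ^ 3) := by gcongr
      _ = 2 * ((n : ℝ) * ((n : ℝ) - 1)) ^ 3 := by ring
  have hlog := Real.log_lt_log (by positivity) key
  rw [Real.log_pow, Real.log_mul (by norm_num) (pow_pos hmpos 3).ne', Real.log_pow] at hlog
  push_cast at hlog
  linarith

end Sets

/-- The case `n = 17`, `C = Cyc₁₇` (written multiplicatively), singled out as optimal in CKSU: the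
census row's closed form **`ω ≤ (6 log 17 − log 2)/log 272 = log(24137569/2)/log 272 = 2.9087956…`**.
[cite: CohnKleinbergSzegedyUmans2005, §2] -/
theorem omega_le_cksu_sec2_seventeen :
    omega ℂ ≤ (6 * Real.log 17 - Real.log 2) / Real.log 272 := by
  have h := omega_le_of_cksu_sec2 (C := Multiplicative (ZMod 17))
    (by rw [Fintype.card_multiplicative, ZMod.card]; norm_num)
  rw [Fintype.card_multiplicative, ZMod.card] at h
  have h272 : Real.log (((17 : ℕ) : ℝ) * (((17 : ℕ) : ℝ) - 1)) = Real.log 272 := by norm_num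
  rwa [h272, Nat.cast_ofNat] at h

/-- **CKSU 2005, §2: "The best bound on `ω` is achieved by setting `n = 17`, in which case we obtain
`ω < 2.9088`"** — from `omega_le_cksu_sec2_seventeen` and the integer certificate
`17^3750 < 2^625 · 272^1818` (i.e. `625 (6 log 17 − log 2) < 1818 log 272`, `2.9088 = 1818/625`).
[cite: CohnKleinbergSzegedyUmans2005, §2] -/
theorem CohnKleinbergSzegedyUmans2005_sec2 : omega ℂ < 2.9088 := by
  have h := omega_le_cksu_sec2_seventeen
  have hlog272 : 0 < Real.log 272 := Real.log_pos (by norm_num)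
  have hpow : (17 : ℝ) ^ 3750 < (2 : ℝ) ^ 625 * (272 : ℝ) ^ 1818 := by
    have : (17 ^ 3750 : ℕ) < 2 ^ 625 * 272 ^ 1818 := by decide +kernel
    exact_mod_cast this
  have hlogs : 3750 * Real.log 17 < 625 * Real.log 2 + 1818 * Real.log 272 := by
    have := Real.log_lt_log (by positivity) hpow
    rwa [Real.log_mul (by positivity) (by positivity), Real.log_pow, Real.log_pow,
      Real.log_pow] at this
  refine lt_of_le_of_lt h ?_
  rw [div_lt_iff₀ hlog272]
  linarith [hlogs, hlog272]

end CKSUIndexTwo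

end Literature.Computability.AlgebraicComplexity

end
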